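import Summits.Ventures.Crystal3D.Theorems.StickyWulffConstantCoaxialWallLawPayerInstance
import HarnessLib

/-!
# End accounting for the word automaton, census-free V: the STATE-INVARIANT instance (translation pairs) —
# sources ≤ 78·#unsaturated + 220·rims

HONEST FRAMING. Part of the venture `Summits/Ventures/Crystal3D` (cell `crystal3d-full`), helper for the crux
`CoaxialWallLaw` (stmt-Ventures-19481) of `route-Ventures-StickyWulffConstant`, REGISTERED line `WallLedgerF`
(planner cf-p1), open stub `stub_coaxialTwoSlabAdhesion` (general fillings).  Rung credit only; F-C1 not moved.

WHY THIS FILE.  The translation-pair instances `word_sources_le_lists_stateInv_exact` (`…ExactInstanceInv`, `22`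
ends per unsaturated ball) and `word_sources_le_lists_stateInv_sharp` (`…SharpInstanceInv`, weight `12 − deg`)
carry the E1 row A12-583 (`hcertA`, the GLIDE STAR) — REFUTED (`…GenericWallFloorGlideStarWitness`,
`…CoaxialWallLawGlideRowRefuted.not_glideStarRow`) — and the sharp one also the census Prop `KFoldTopDeficit`
(refuted at glide arrivals); both are conditional on false hypotheses (planner cf-p1 ROUTE §84 (xii): inadmissible).
This is their CENSUS-FREE replacement (option (A); recipe of 19481-p1 g6, INBOX 2026-08-28T05:44:06Z): the text of
`word_sources_le_lists_stateInv_sharp` with the end charging of 19481-p1's in-plane instance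
`word_sources_le_lists_payers` (`…PayerInstance`):

**Theorem (`word_sources_le_lists_stateInv_payers`).**  Word data `F, u, WF, next`, a state invariant `P` (holds at
the first image of every source, preserved by the move forms, EXCLUDES the top sample), the top grain as a frame,
rising root direction, the two-slab cell; inputs BY NAME: `KissingGap δ`, `KissingClassification δ` ONLY (through
`word_reachable_end_two_payers` of `…EndDichotomy`).  Then

  `#sources ≤ 78 · #{z ∈ X : deg z ≤ 11, −R₀−2 ≤ z₂ ≤ h+R₀+2} + 220 · #rim_top + 220 · #rim_bottom`:

a reachable end at an UNSATURATED ball is charged there (`≤ deg ≤ 12` reached states per ball,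
`card_reached_ends_le_card_contacts`, distinct predecessors; word rigidity `word_eq_of_triangle` and glide
non-return `word_image_ne_glideMirror` discharged here for well-formed words); a reachable end at a SATURATED ball
has two distinct unsaturated contact neighbours and is charged `½` to each (`≤ ½·11·12 = 66` per payer); `78 = 12 + 66`.

With the payer assembly (`twoSlab_cross_le_of_payers` of `…PayerAssembly`) this gives charge `√2 α/156` per root of
rise `α` for translation pairs (`…PayerTrans`), census-free.

WHAT THIS IS NOT: not the stub; the constant `78` is the crude sharing bound; F-C1 not moved.
-/

noncomputable section

namespace Summit.Ventures.Crystal3D.Theorems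

open Summit.Ventures.Crystal3D Finset
open Literature.MathematicalPhysics.StatisticalMechanics (fccStacking)
open scoped InnerProductSpace

section Instance

variable {X : Finset (EuclideanSpace ℝ (Fin 3))}
  {F : List (EuclideanSpace ℝ (Fin 3)) → (EuclideanSpace ℝ (Fin 3) ≃ₗᵢ[ℝ] EuclideanSpace ℝ (Fin 3))}
  {u : List (EuclideanSpace ℝ (Fin 3)) → EuclideanSpace ℝ (Fin 3)}
  {WF : List (EuclideanSpace ℝ (Fin 3)) → Prop}
  {next : List (EuclideanSpace ℝ (Fin 3)) → EuclideanSpace ℝ (Fin 3) → List (EuclideanSpace ℝ (Fin 3))}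
  {P₁ P' P₂ : Finset (EuclideanSpace ℝ (Fin 3))} {t₁ t₂ : EuclideanSpace ℝ (Fin 3)} {R₀ h ρ : ℝ}

open scoped Classical in
/-- **The census-free count under a state invariant, instantiated for well-formed words.**  See the module
docstring. -/
theorem word_sources_le_lists_stateInv_payers {δ : ℝ} (hg : KissingGap δ) (hc : KissingClassification δ)
    (hX : ∀ p ∈ X, ∀ q ∈ X, p ≠ q → 1 ≤ dist p q)
    (hFc : ∀ μ κ, F (μ :: κ) = ((ℝ ∙ μ)ᗮ.reflection).trans (F κ))
    (hu : ∀ κ, u κ ∈ fccSlots) (huc : ∀ μ κ, u (μ :: κ) = -u κ)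
    (hWF0 : WF [])
    (hWFc : ∀ μ κ, WF (μ :: κ) ↔ (WF κ ∧ ‖μ‖ = 1 ∧
      (∀ w ∈ fccSlots, ⟪w, μ⟫_ℝ = 0 ∨ ⟪w, μ⟫_ℝ = Real.sqrt (2 / 3) ∨ ⟪w, μ⟫_ℝ = -Real.sqrt (2 / 3)) ∧
      ⟪u κ, μ⟫_ℝ = Real.sqrt (2 / 3) ∧ ∀ μ' κ', κ = μ' :: κ' → μ' ≠ -μ))
    (hnext_pop : ∀ μ κ' (m : EuclideanSpace ℝ (Fin 3)), (F (μ :: κ')).symm m = -μ → next (μ :: κ') m = κ')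
    (hnext_push : ∀ κ (m : EuclideanSpace ℝ (Fin 3)), (∀ μ κ', κ = μ :: κ' → (F κ).symm m ≠ -μ) →
      next κ m = (F κ).symm m :: κ)
    -- the top grain's frame and the state invariant
    (G₂ : EuclideanSpace ℝ (Fin 3) ≃ₗᵢ[ℝ] EuclideanSpace ℝ (Fin 3))
    {P : EuclideanSpace ℝ (Fin 3) × List (EuclideanSpace ℝ (Fin 3)) → Prop}
    (hPfull : ∀ (b : EuclideanSpace ℝ (Fin 3)) (κ : List (EuclideanSpace ℝ (Fin 3))), WF κ →
      P (b, κ) → P (b + F κ (u κ), κ))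
    (hPcross : ∀ (b : EuclideanSpace ℝ (Fin 3)) (κ : List (EuclideanSpace ℝ (Fin 3))) (m : EuclideanSpace ℝ (Fin 3)),
      WF κ → WF (next κ m) → P (b, κ) → P (b + F (next κ m) (u (next κ m)), next κ m))
    (hPtop : ∀ (b : EuclideanSpace ℝ (Fin 3)) (κ : List (EuclideanSpace ℝ (Fin 3))), WF κ → P (b, κ) → b ∉ P₂)
    (hup : 0 < (F [] (u [])) 2)
    -- the cell
    (hR₀ : 3 ≤ R₀) (hρ : R₀ ≤ ρ)
    (hcell : ∀ p ∈ X, -(2 * R₀) ≤ p 2 ∧ p 2 ≤ h + 2 * R₀ ∧ p 0 ^ 2 + p 1 ^ 2 ≤ ρ ^ 2)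
    (hP₁X : P₁ ⊆ X) (hP₂X : P₂ ⊆ X)
    (hP₁ : ∀ p, p ∈ P₁ ↔ (p ∈ (fun q => F [] q + t₁) '' fccStacking 1 (Real.sqrt (2 / 3)) ∧
      -(2 * R₀) ≤ p 2 ∧ p 2 ≤ -R₀ ∧ p 0 ^ 2 + p 1 ^ 2 ≤ ρ ^ 2))
    (hP' : ∀ p, p ∈ P' ↔ (p ∈ (fun q => F [] q + t₁) '' fccStacking 1 (Real.sqrt (2 / 3)) ∧
      -(2 * R₀) + 1 ≤ p 2 ∧ p 2 ≤ -R₀ - 1 ∧ p 0 ^ 2 + p 1 ^ 2 ≤ (ρ - 1) ^ 2))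
    (hP'full : ∀ p ∈ P', ∀ w ∈ fccSlots, p + F [] w ∈ X)
    (hPsrc : ∀ p ∈ P', P (p + F [] (u []), []))
    (hP₂ : ∀ p, p ∈ P₂ ↔ (p ∈ (fun q => G₂ q + t₂) '' fccStacking 1 (Real.sqrt (2 / 3)) ∧
      h + R₀ ≤ p 2 ∧ p 2 ≤ h + 2 * R₀ ∧ p 0 ^ 2 + p 1 ^ 2 ≤ ρ ^ 2)) :
    (P'.filter fun p => (∀ w ∈ fccSlots, p + F [] w ∈ X) ∧
        -R₀ - 1 < (p + F [] (u [])) 2 ∧ (p + F [] (u [])) 2 < h + R₀ + 1).card ≤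
      78 * (X.filter fun z => (X.filter fun q => dist z q = 1).card ≤ 11 ∧
          -R₀ - 1 - 1 ≤ z 2 ∧ z 2 ≤ h + R₀ + 1 + 1).card +
      220 * (X.filter fun s => h + R₀ + 1 ≤ s 2 ∧ s 2 ≤ h + R₀ + 1 + 1 ∧ (ρ - 2) ^ 2 < s 0 ^ 2 + s 1 ^ 2).card +
      220 * (X.filter fun s => -R₀ - 1 - 1 ≤ s 2 ∧ s 2 < -R₀ - 1 ∧ (ρ - 1) ^ 2 < s 0 ^ 2 + s 1 ^ 2).card := by
  -- the class data on the subtype of well-formed words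
  set F' : {κ : List (EuclideanSpace ℝ (Fin 3)) // WF κ} →
      (EuclideanSpace ℝ (Fin 3) ≃ₗᵢ[ℝ] EuclideanSpace ℝ (Fin 3)) := fun κ => F κ.1 with hF'
  set d' : {κ : List (EuclideanSpace ℝ (Fin 3)) // WF κ} → EuclideanSpace ℝ (Fin 3) :=
    fun κ => F κ.1 (u κ.1) with hd'
  set next' : {κ : List (EuclideanSpace ℝ (Fin 3)) // WF κ} → EuclideanSpace ℝ (Fin 3) →
      {κ : List (EuclideanSpace ℝ (Fin 3)) // WF κ} := fun κ m =>
    @dite _ (WF (next κ.1 m)) (Classical.propDecidable _) (fun hw => ⟨next κ.1 m, hw⟩) (fun _ => κ) with hnext'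
  set root : {κ : List (EuclideanSpace ℝ (Fin 3)) // WF κ} := ⟨[], hWF0⟩ with hroot_def
  -- the class change along a crossing normal
  have hspec : ∀ (κ : {κ : List (EuclideanSpace ℝ (Fin 3)) // WF κ}) (m : EuclideanSpace ℝ (Fin 3)), ‖m‖ = 1 →
      (∀ w ∈ fccSlots, ⟪F' κ w, m⟫_ℝ = 0 ∨ ⟪F' κ w, m⟫_ℝ = Real.sqrt (2 / 3) ∨ ⟪F' κ w, m⟫_ℝ = -Real.sqrt (2 / 3)) →
      ⟪d' κ, m⟫_ℝ = Real.sqrt (2 / 3) →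
      (next' κ m).1 = next κ.1 m ∧ (∀ x, F (next κ.1 m) x = F κ.1 x - (2 * ⟪F κ.1 x, m⟫_ℝ) • m) ∧
        ⟪F (next κ.1 m) (u (next κ.1 m)), m⟫_ℝ = Real.sqrt (2 / 3) ∧ next (next κ.1 m) m = κ.1 := by
    intro κ m hm hmenu hdm
    obtain ⟨hwf, hfr, hdir, hinv⟩ := word_next_spec hFc huc hWFc hnext_pop hnext_push κ.2 hm hmenu hdm
    refine ⟨?_, hfr, hdir, hinv⟩
    simp only [hnext']
    rw [dif_pos hwf]
  have hmirror : ∀ (κ : {κ : List (EuclideanSpace ℝ (Fin 3)) // WF κ}) (m : EuclideanSpace ℝ (Fin 3)), ‖m‖ = 1 →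
      (∀ w ∈ fccSlots, ⟪F' κ w, m⟫_ℝ = 0 ∨ ⟪F' κ w, m⟫_ℝ = Real.sqrt (2 / 3) ∨ ⟪F' κ w, m⟫_ℝ = -Real.sqrt (2 / 3)) →
      ⟪d' κ, m⟫_ℝ = Real.sqrt (2 / 3) → ∀ x, F' (next' κ m) x = F' κ x - (2 * ⟪F' κ x, m⟫_ℝ) • m := by
    intro κ m hm hmenu hdm x
    obtain ⟨h1, hfr, -, -⟩ := hspec κ m hm hmenu hdm
    show F (next' κ m).1 x = F κ.1 x - (2 * ⟪F κ.1 x, m⟫_ℝ) • m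
    rw [h1]; exact hfr x
  have hinv : ∀ (κ : {κ : List (EuclideanSpace ℝ (Fin 3)) // WF κ}) (m : EuclideanSpace ℝ (Fin 3)), ‖m‖ = 1 →
      (∀ w ∈ fccSlots, ⟪F' κ w, m⟫_ℝ = 0 ∨ ⟪F' κ w, m⟫_ℝ = Real.sqrt (2 / 3) ∨ ⟪F' κ w, m⟫_ℝ = -Real.sqrt (2 / 3)) →
      ⟪d' κ, m⟫_ℝ = Real.sqrt (2 / 3) → next' (next' κ m) m = κ := by
    intro κ m hm hmenu hdm
    obtain ⟨h1, -, -, hback⟩ := hspec κ m hm hmenu hdm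
    apply Subtype.ext
    have h2 : (next' (next' κ m) m).1 = next (next' κ m).1 m := by
      simp only [hnext']
      rw [dif_pos]
      rw [h1, hback]; exact κ.2
    rw [h2, h1, hback]
  have hdnext : ∀ (κ : {κ : List (EuclideanSpace ℝ (Fin 3)) // WF κ}) (m : EuclideanSpace ℝ (Fin 3)), ‖m‖ = 1 →
      (∀ w ∈ fccSlots, ⟪F' κ w, m⟫_ℝ = 0 ∨ ⟪F' κ w, m⟫_ℝ = Real.sqrt (2 / 3) ∨ ⟪F' κ w, m⟫_ℝ = -Real.sqrt (2 / 3)) →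
      ⟪d' κ, m⟫_ℝ = Real.sqrt (2 / 3) → ⟪d' (next' κ m), m⟫_ℝ = Real.sqrt (2 / 3) := by
    intro κ m hm hmenu hdm
    obtain ⟨h1, -, hdir, -⟩ := hspec κ m hm hmenu hdm
    show ⟪F (next' κ m).1 (u (next' κ m).1), m⟫_ℝ = Real.sqrt (2 / 3)
    rw [h1]; exact hdir
  have hd : ∀ κ : {κ : List (EuclideanSpace ℝ (Fin 3)) // WF κ}, ∃ u' ∈ fccSlots, d' κ = F' κ u' :=
    fun κ => ⟨u κ.1, hu κ.1, rfl⟩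
  have hdn : ∀ κ : {κ : List (EuclideanSpace ℝ (Fin 3)) // WF κ}, ∃ m : EuclideanSpace ℝ (Fin 3), ‖m‖ = 1 ∧
      (∀ w ∈ fccSlots, ⟪F' κ w, m⟫_ℝ = 0 ∨ ⟪F' κ w, m⟫_ℝ = Real.sqrt (2 / 3) ∨ ⟪F' κ w, m⟫_ℝ = -Real.sqrt (2 / 3)) ∧
      ⟪d' κ, m⟫_ℝ = Real.sqrt (2 / 3) := fun κ => exists_menuNormal_far (F κ.1) (hu κ.1)
  -- rigidity: the slot dozen determines the word
  have hinjK : ∀ κ κ' : {κ : List (EuclideanSpace ℝ (Fin 3)) // WF κ},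
      (F' κ : EuclideanSpace ℝ (Fin 3) → EuclideanSpace ℝ (Fin 3)) '' ↑fccSlots =
      (F' κ' : EuclideanSpace ℝ (Fin 3) → EuclideanSpace ℝ (Fin 3)) '' ↑fccSlots → κ = κ' :=
    fun κ κ' himg => Subtype.ext (word_eq_of_image_eq hFc huc hWFc κ.2 κ'.2 himg)
  have hrig : ∀ κ κ' : {κ : List (EuclideanSpace ℝ (Fin 3)) // WF κ},
      (∃ a ∈ fccSlots, ∃ a' ∈ fccSlots, ∃ a'' ∈ fccSlots,
        ⟪a, a'⟫_ℝ = 1 / 2 ∧ ⟪a, a''⟫_ℝ = 1 / 2 ∧ ⟪a', a''⟫_ℝ = 1 / 2 ∧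
        (∃ w ∈ fccSlots, F' κ' w = F' κ a) ∧ (∃ w ∈ fccSlots, F' κ' w = F' κ a') ∧
        (∃ w ∈ fccSlots, F' κ' w = F' κ a'')) → κ = κ' :=
    fun κ κ' htri => Subtype.ext (word_eq_of_triangle hFc huc hWFc κ.2 κ'.2 htri)
  -- glide non-return for well-formed words (19481-p1's `word_image_ne_glideMirror`, normal pulled back to the model)
  have hnoglide : ∀ (κ κ' : {κ : List (EuclideanSpace ℝ (Fin 3)) // WF κ}) (m : EuclideanSpace ℝ (Fin 3)), ‖m‖ = 1 →
      (∀ w ∈ fccSlots, ⟪F' κ w, m⟫_ℝ = 0 ∨ ⟪F' κ w, m⟫_ℝ = Real.sqrt (2 / 3) ∨ ⟪F' κ w, m⟫_ℝ = -Real.sqrt (2 / 3)) →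
      ⟪d' κ, m⟫_ℝ = 0 →
      (F' κ' : EuclideanSpace ℝ (Fin 3) → EuclideanSpace ℝ (Fin 3)) '' ↑fccSlots ≠
        (fun x => F' κ x - (2 * ⟪F' κ x, m⟫_ℝ) • m) '' ↑fccSlots := by
    intro κ κ' m hm hmenu hdm
    set μ : EuclideanSpace ℝ (Fin 3) := (F κ.1).symm m with hμ
    have hFμ : F κ.1 μ = m := by rw [hμ, LinearIsometryEquiv.apply_symm_apply]
    have hμ1 : ‖μ‖ = 1 := by rw [hμ, LinearIsometryEquiv.norm_map, hm]
    have hμmenu : ∀ w ∈ fccSlots, ⟪w, μ⟫_ℝ = 0 ∨ ⟪w, μ⟫_ℝ = Real.sqrt (2 / 3) ∨ ⟪w, μ⟫_ℝ = -Real.sqrt (2 / 3) := by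
      intro w hw; rw [← LinearIsometryEquiv.inner_map_map (F κ.1) w μ, hFμ]; exact hmenu w hw
    have horth : ⟪u κ.1, μ⟫_ℝ = 0 := by
      rw [← LinearIsometryEquiv.inner_map_map (F κ.1) (u κ.1) μ, hFμ]; exact hdm
    have key := word_image_ne_glideMirror hFc huc hWFc κ.2 hμ1 hμmenu horth κ'.2
    have e : (fun x => F κ.1 (x - (2 * ⟪x, μ⟫_ℝ) • μ)) = fun x => F' κ x - (2 * ⟪F' κ x, m⟫_ℝ) • m := by
      funext x
      show F κ.1 (x - (2 * ⟪x, μ⟫_ℝ) • μ) = F κ.1 x - (2 * ⟪F κ.1 x, m⟫_ℝ) • m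
      rw [← hFμ, mirror_conj]
    rw [e] at key; exact key
  -- the certified states and the move map
  obtain ⟨W, hW, hmult⟩ := exists_certified_states (F := F') (d := d') hX hinjK
  obtain ⟨f, hf_full, hf_cross, hf_glide⟩ := exists_word_move_map X F' d' next'
  -- the invariant, lifted to the subtype of well-formed words
  set Pw : EuclideanSpace ℝ (Fin 3) × {κ : List (EuclideanSpace ℝ (Fin 3)) // WF κ} → Prop :=
    fun v => P (v.1, v.2.1) with hPwdef
  have hPsrc' : ∀ p ∈ P', (∀ w ∈ fccSlots, p + F' root w ∈ X) → Pw (p + d' root, root) :=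
    fun p hp _ => hPsrc p hp
  have hPfull' : ∀ v ∈ W, Pw v → Pw (v.1 + d' v.2, v.2) := fun v _ hv => hPfull v.1 v.2.1 v.2.2 hv
  have hPcross' : ∀ v ∈ W, ∀ (m : EuclideanSpace ℝ (Fin 3)), ‖m‖ = 1 →
      (∀ w ∈ fccSlots, ⟪F' v.2 w, m⟫_ℝ = 0 ∨ ⟪F' v.2 w, m⟫_ℝ = Real.sqrt (2 / 3) ∨ ⟪F' v.2 w, m⟫_ℝ = -Real.sqrt (2 / 3)) →
      ⟪d' v.2, m⟫_ℝ = Real.sqrt (2 / 3) → Pw v → Pw (v.1 + d' (next' v.2 m), next' v.2 m) := by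
    intro v _ m hm hmenu hdm hv
    obtain ⟨h1, -, -, -⟩ := hspec v.2 m hm hmenu hdm
    have hwf : WF (next v.2.1 m) := by rw [← h1]; exact (next' v.2 m).2
    show P ((v.1 + F (next' v.2 m).1 (u (next' v.2 m).1), (next' v.2 m).1))
    rw [h1]
    exact hPcross v.1 v.2.1 m v.2.2 hwf hv
  have hPexcl : ∀ v ∈ W, Pw v → v.1 ∈ P₂ → (∀ w ∈ fccSlots, v.1 + G₂ w ∈ X) → False :=
    fun v _ hv hvP _ => hPtop v.1 v.2.1 v.2.2 hv hvP
  -- the abstract exact count under the state invariant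
  have key := word_sources_le_exact (root := root) (G₂ := G₂) (P := Pw) hX hd hdn hmirror hinv hdnext hW
    hmult (fun v _ => hf_full v) (fun v _ => hf_cross v) (fun v _ => hf_glide v)
    (fun κ hκ => hrig κ root hκ) hup hPsrc' hPfull' hPcross' hPexcl hR₀ hρ hcell hP₁X hP₂X hP₁ hP' hP'full hP₂
  -- the reachable ends: each sits on an unsaturated ball of the window, at most 22 per ball
  set mov : EuclideanSpace ℝ (Fin 3) × {κ : List (EuclideanSpace ℝ (Fin 3)) // WF κ} → Prop := fun v =>
    (∀ w ∈ fccSlots, v.1 + F' v.2 w ∈ X) ∨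
      ∃ m : EuclideanSpace ℝ (Fin 3), ‖m‖ = 1 ∧
        (∀ w ∈ fccSlots, ⟪F' v.2 w, m⟫_ℝ = 0 ∨ ⟪F' v.2 w, m⟫_ℝ = Real.sqrt (2 / 3) ∨ ⟪F' v.2 w, m⟫_ℝ = -Real.sqrt (2 / 3)) ∧
        (∀ w ∈ fccSlots, ⟪F' v.2 w, m⟫_ℝ ≤ 0 → v.1 + F' v.2 w ∈ X) ∧
        (∀ w ∈ fccSlots, ⟪F' v.2 w, m⟫_ℝ < 0 → v.1 + (F' v.2 w - (2 * ⟪F' v.2 w, m⟫_ℝ) • m) ∈ X) ∧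
        (∀ w ∈ fccSlots, 0 < ⟪F' v.2 w, m⟫_ℝ → v.1 + F' v.2 w ∉ X) ∧
        (⟪d' v.2, m⟫_ℝ = Real.sqrt (2 / 3) ∨ ⟪d' v.2, m⟫_ℝ = 0) with hmov
  -- the end set of the abstract count, in membership form
  obtain ⟨E, hkey, hEmem⟩ : ∃ E : Finset (EuclideanSpace ℝ (Fin 3) × {κ : List (EuclideanSpace ℝ (Fin 3)) // WF κ}),
      (P'.filter fun p => (∀ w ∈ fccSlots, p + F [] w ∈ X) ∧
          -R₀ - 1 < (p + F [] (u [])) 2 ∧ (p + F [] (u [])) 2 < h + R₀ + 1).card ≤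
        E.card +
        220 * (X.filter fun s => h + R₀ + 1 ≤ s 2 ∧ s 2 ≤ h + R₀ + 1 + 1 ∧ (ρ - 2) ^ 2 < s 0 ^ 2 + s 1 ^ 2).card +
        220 * (X.filter fun s => -R₀ - 1 - 1 ≤ s 2 ∧ s 2 < -R₀ - 1 ∧ (ρ - 1) ^ 2 < s 0 ^ 2 + s 1 ^ 2).card ∧
      ∀ v, v ∈ E ↔ v ∈ W ∧ (-R₀ - 1 ≤ v.1 2 ∧ v.1 2 < h + R₀ + 1 ∧ ¬ mov v ∧ Pw v ∧
        ∃ u ∈ W, mov u ∧ f u = v) :=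
    ⟨_, key, fun v => by simp only [Finset.mem_filter, hmov]⟩
  set PAY := X.filter fun z => (X.filter fun q => dist z q = 1).card ≤ 11 ∧
    -R₀ - 1 - 1 ≤ z 2 ∧ z 2 ≤ h + R₀ + 1 + 1 with hPAY
  -- the states reached at any ball: at most `deg ≤ 12` (distinct predecessors)
  obtain ⟨Rb, hRbcard, hRbmem⟩ : ∃ Rb : EuclideanSpace ℝ (Fin 3) →
      Finset (EuclideanSpace ℝ (Fin 3) × {κ : List (EuclideanSpace ℝ (Fin 3)) // WF κ}),
      (∀ b, (Rb b).card ≤ (X.filter fun q => dist b q = 1).card) ∧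
      ∀ b v, v ∈ Rb b ↔ v ∈ W ∧ (v.1 = b ∧ ∃ u ∈ W, mov u ∧ f u = v) :=
    ⟨_, fun b => card_reached_ends_le_card_contacts hX hd hdn hmirror hdnext hW (fun v _ => hf_full v)
      (fun v _ => hf_cross v) (fun v _ => hf_glide v) hrig hnoglide b, fun b v => by simp only [Finset.mem_filter, hmov]⟩
  have hRb12 : ∀ b, (Rb b).card ≤ 12 := fun b => (hRbcard b).trans (card_filter_dist_eq_one_le_twelve X hX b)
  have hERb : ∀ v ∈ E, v ∈ Rb v.1 := by
    intro v hv
    obtain ⟨hvW, -, -, -, -, hu⟩ := (hEmem v).1 hv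
    exact (hRbmem v.1 v).2 ⟨hvW, rfl, hu⟩
  -- an end ball is in the window; a contact neighbour of it is in the widened window
  have hEwin : ∀ v ∈ E, -R₀ - 1 ≤ v.1 2 ∧ v.1 2 < h + R₀ + 1 := fun v hv => ⟨((hEmem v).1 hv).2.1, ((hEmem v).1 hv).2.2.1⟩
  have hnbwin : ∀ v ∈ E, ∀ z : EuclideanSpace ℝ (Fin 3), dist v.1 z = 1 →
      -R₀ - 1 - 1 ≤ z 2 ∧ z 2 ≤ h + R₀ + 1 + 1 := by
    intro v hv z hdz
    obtain ⟨h1, h2⟩ := hEwin v hv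
    have hsq := sq_sub_apply_le_dist_sq z v.1 2
    rw [dist_comm, hdz, one_pow] at hsq
    have habs : |z 2 - v.1 2| ≤ 1 := by rw [← sq_le_one_iff_abs_le_one]; exact hsq
    obtain ⟨hl, hu'⟩ := abs_le.1 habs
    exact ⟨by linarith, by linarith⟩
  -- split the ends: unsaturated own ball / saturated own ball
  set Eu := E.filter fun v => (X.filter fun q => dist v.1 q = 1).card ≤ 11 with hEu
  set Es := E.filter fun v => ¬ (X.filter fun q => dist v.1 q = 1).card ≤ 11 with hEs
  have hEsplit : E.card = Eu.card + Es.card := by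
    rw [hEu, hEs]; exact (card_filter_add_card_filter_not _).symm
  -- (1) ends at unsaturated balls: `≤ 12` per payer
  have hEu_le : Eu.card ≤ 12 * PAY.card := by
    have hcov : Eu ⊆ PAY.biUnion fun z => Rb z := by
      intro v hv
      obtain ⟨hvE, hdeg⟩ := mem_filter.1 hv
      obtain ⟨h1, h2⟩ := hEwin v hvE
      rw [mem_biUnion]
      refine ⟨v.1, mem_filter.2 ⟨((hW v).1 ((hEmem v).1 hvE).1).1, hdeg, by linarith, by linarith⟩, hERb v hvE⟩
    calc Eu.card ≤ (PAY.biUnion fun z => Rb z).card := card_le_card hcov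
      _ ≤ ∑ z ∈ PAY, (Rb z).card := card_biUnion_le
      _ ≤ ∑ z ∈ PAY, 12 := sum_le_sum fun z _ => hRb12 z
      _ = 12 * PAY.card := by rw [sum_const, smul_eq_mul, mul_comm]
  -- (2) ends at saturated balls: two unsaturated contact neighbours each, `≤ 11·12` per payer
  have hEs_two : ∀ v ∈ Es, 2 ≤ (PAY.filter fun z => dist v.1 z = 1).card := by
    intro v hv
    obtain ⟨hvE, hdeg⟩ := mem_filter.1 hv
    obtain ⟨hvW, -, -, hnm, -, u', hu'W, hum, hfu⟩ := (hEmem v).1 hvE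
    have hnm' : ¬ mov (f u') := by rw [hfu]; exact hnm
    rcases word_reachable_end_two_payers hg hc hX hd hdn hmirror hdnext hW (fun v _ => hf_full v)
        (fun v _ => hf_cross v) (fun v _ => hf_glide v) hu'W hum hnm' with h11 | ⟨z₁, hz₁, z₂, hz₂, hne, hd₁, hd₂, hc₁, hc₂⟩
    · rw [hfu] at h11; exact absurd h11 hdeg
    · rw [hfu] at hd₁ hd₂
      have hz₁P : z₁ ∈ PAY.filter fun z => dist v.1 z = 1 :=
        mem_filter.2 ⟨mem_filter.2 ⟨hz₁, hc₁, hnbwin v hvE z₁ hd₁⟩, hd₁⟩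
      have hz₂P : z₂ ∈ PAY.filter fun z => dist v.1 z = 1 :=
        mem_filter.2 ⟨mem_filter.2 ⟨hz₂, hc₂, hnbwin v hvE z₂ hd₂⟩, hd₂⟩
      calc 2 = ({z₁, z₂} : Finset _).card := (card_pair hne).symm
        _ ≤ _ := card_le_card (by
          intro z hz
          rcases mem_insert.1 hz with rfl | hz
          · exact hz₁P
          · rw [mem_singleton.1 hz]; exact hz₂P)
  have hfib : ∀ z ∈ PAY, (Es.filter fun v => dist v.1 z = 1).card ≤ 11 * 12 := by
    intro z hz
    obtain ⟨hzX, hdeg, -, -⟩ := mem_filter.1 hz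
    have hcov : (Es.filter fun v => dist v.1 z = 1) ⊆ (X.filter fun q => dist z q = 1).biUnion fun b => Rb b := by
      intro v hv
      obtain ⟨hvEs, hdz⟩ := mem_filter.1 hv
      have hvE : v ∈ E := (mem_filter.1 hvEs).1
      rw [mem_biUnion]
      refine ⟨v.1, mem_filter.2 ⟨((hW v).1 ((hEmem v).1 hvE).1).1, by rw [dist_comm]; exact hdz⟩, hERb v hvE⟩
    calc (Es.filter fun v => dist v.1 z = 1).card
        ≤ ((X.filter fun q => dist z q = 1).biUnion fun b => Rb b).card := card_le_card hcov
      _ ≤ ∑ b ∈ X.filter (fun q => dist z q = 1), (Rb b).card := card_biUnion_le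
      _ ≤ ∑ b ∈ X.filter (fun q => dist z q = 1), 12 := sum_le_sum fun b _ => hRb12 b
      _ = 12 * (X.filter fun q => dist z q = 1).card := by rw [sum_const, smul_eq_mul, mul_comm]
      _ ≤ 11 * 12 := by omega
  have hEs_le : 2 * Es.card ≤ 132 * PAY.card := by
    have hdc := Finset.sum_card_bipartiteAbove_eq_sum_card_bipartiteBelow
      (s := Es) (t := PAY) (r := fun v z => dist v.1 z = 1)
    calc 2 * Es.card = ∑ v ∈ Es, 2 := by rw [sum_const, smul_eq_mul, mul_comm]
      _ ≤ ∑ v ∈ Es, (PAY.bipartiteAbove (fun v z => dist v.1 z = 1) v).card := sum_le_sum fun v hv => hEs_two v hv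
      _ = ∑ z ∈ PAY, (Es.bipartiteBelow (fun v z => dist v.1 z = 1) z).card := hdc
      _ ≤ ∑ z ∈ PAY, 11 * 12 := sum_le_sum fun z hz => hfib z hz
      _ = 132 * PAY.card := by rw [sum_const, smul_eq_mul]; ring
  have hEcard : E.card ≤ 78 * PAY.card := by omega
  exact hkey.trans (by omega)

end Instance

end Summit.Ventures.Crystal3D.Theorems

end
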